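import Literature.Topology.FourManifolds.InteriorDiscs
import Literature.Topology.FourManifolds.SmoothEmbeddingComp
import HarnessLib

/-!
# Transport of compactly supported diffeomorphisms along a disc; embeddings of smaller opens

Topic `Literature/Topology/FourManifolds` (general differential topology; brick [B2b] of the
discharge of `Literature.Topology.FourManifolds.nonempty_diffeomorph_of_isOrientedConnectedSum` at
arbitrary models, see `ConnectedSumUniquenessProofs.lean`).

* `Literature.Topology.FourManifolds.exists_diffeomorph_discTransport`: let `k : E → N` be a disc
  (smooth embedding of the finite-dimensional model vector space) in a Hausdorff manifold `N`
  modelled on an *arbitrary* real model with corners `I`, and `s` a diffeomorphism of `E` equal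
  to the identity off a ball `B̄(0, R)`. Then `k ∘ s ∘ k⁻¹`, extended by the identity, is a
  diffeomorphism `γ` of `N` (for the model `I`) with `γ ∘ k = k ∘ s` and `γ = id` off
  `k '' B̄(0, R)`. This is `exists_diffeomorph_chartTransport` of `ChartTransport.lean` (Hirsch,
  *Differential Topology* (1976), Ch. 8 §1, Thms. 1.3–1.4, static form) with the boundaryless
  hypothesis on `N` removed: the chart `k⁻¹ : N ⊇ k(E) → E` is smooth for any target model
  (`contMDiffOn_symm_disc`, `InteriorDiscs.lean`), and the transport `chartTransport` of that
  file is model-free.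
* `Literature.Topology.FourManifolds.isSmoothEmbedding_comp_opensInclusion`: a smooth embedding
  `f : V → P` of an open submanifold `V ⊆ N` restricts to a smooth embedding of any smaller open
  `U ≤ V` (`f ∘ Opens.inclusion`), with open range when `range f` is open (Lee, *Introduction
  to Smooth Manifolds* (2013), Ch. 5: restrictions of embeddings to open subsets). The inclusion
  is packaged as a globally defined partial diffeomorphism `U ⇀ V` (`inclusionOpenPartialHomeomorph`,
  from Mathlib's `Opens.isOpenEmbedding_of_le`) and the tree's
  `Manifold.IsSmoothEmbedding.comp_openPartialHomeomorph` applies.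

Everything is proved; no named facts.

## Design notes

* refactor: the tree's `Literature.Topology.FourManifolds.isSmoothEmbedding_comp_inclusion`
  (`KirbyMovesBlowDown.lean`) has exactly the statement of
  `isSmoothEmbedding_comp_opensInclusion` below (smooth-embedding clause and open-range clause,
  no nonemptiness hypothesis) but lives behind the Kirby-calculus imports of that file, which the
  connected-sum files must not pull in; it is now the one-liner
  `isSmoothEmbedding_comp_opensInclusion h hf` and can be collapsed onto it by the librarian,
  re-pointing its call sites `KirbyMovesBlowDown.lean:395`, `KirbyMovesBlowDownProofs.lean:83`,
  `KirbyMovesHandleSlide.lean:398,507`, `LinkSurgeryExistence.lean:297,405`,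
  `LinkSurgeryFramedUniqueness.lean:278,280`.
* refactor: likewise `contMDiff_chartTransport` (`ChartTransport.lean`, model `𝓘(ℝ, E)`,
  `[ProperSpace E]`) is the instance `I = 𝓘(ℝ, E)` of `contMDiff_chartTransport_of_model` below
  (same hypotheses `[ProperSpace E] [T2Space N]`) and becomes the one-liner
  `contMDiff_chartTransport_of_model hφ hφ' htarget hsm hs`.

## References

* M. W. Hirsch, *Differential Topology*, GTM 33 (1976), Ch. 8 §1, Thms. 1.3–1.4. [HirschDT1976]
* J. M. Lee, *Introduction to Smooth Manifolds*, 2nd ed. (2013), Ch. 5. [LeeSmoothManifolds2013]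
-/

open scoped Manifold ContDiff Topology
open Set Function Filter TopologicalSpace

noncomputable section

namespace Literature.Topology.FourManifolds

/-! ### Transport along a disc, arbitrary target model -/

section DiscTransport

variable {E : Type*} [NormedAddCommGroup E] [NormedSpace ℝ E] [FiniteDimensional ℝ E]
  {H : Type*} [TopologicalSpace H] {I : ModelWithCorners ℝ E H}
  {N : Type*} [TopologicalSpace N] [T2Space N] [ChartedSpace H N]

omit [FiniteDimensional ℝ E] in
/-- **Smoothness of the transport along a chart onto `E`, arbitrary model on `N`.** If
`φ : N ⊇ U → E` is a partial homeomorphism onto the whole of `E` (a proper space) which is `C^∞`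
for the models `I`, `𝓘(ℝ, E)` with `C^∞` inverse, and `s : E → E` is `C^∞` and the identity off
`B̄(0, R)`, then `chartTransport φ s` (`φ⁻¹ ∘ s ∘ φ` on `U`, the identity elsewhere) is `C^∞` for
the model `I` (same proof as `contMDiff_chartTransport`, which is the case `I = 𝓘(ℝ, E)`).
[folklore] -/
theorem contMDiff_chartTransport_of_model [ProperSpace E] {φ : OpenPartialHomeomorph N E}
    (hφ : ContMDiffOn I 𝓘(ℝ, E) ∞ φ φ.source) (hφ' : ContMDiff 𝓘(ℝ, E) I ∞ φ.symm)
    (htarget : φ.target = univ) {s : E → E} (hsm : ContMDiff 𝓘(ℝ, E) 𝓘(ℝ, E) ∞ s) {R : ℝ}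
    (hs : ∀ y, R ≤ ‖y‖ → s y = y) : ContMDiff I I ∞ (chartTransport φ s) := by
  intro x
  by_cases hxs : x ∈ φ.source
  · have hev : chartTransport φ s =ᶠ[𝓝 x] fun z ↦ φ.symm (s (φ z)) :=
      Filter.eventuallyEq_of_mem (φ.open_source.mem_nhds hxs)
        fun z hz ↦ chartTransport_of_mem s hz
    refine ContMDiffAt.congr_of_eventuallyEq ?_ hev
    exact hφ'.contMDiffAt.comp x (hsm.contMDiffAt.comp x (hφ.contMDiffAt
      (φ.open_source.mem_nhds hxs)))
  · have hK : IsClosed (φ.symm '' Metric.closedBall (0 : E) R) :=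
      ((isCompact_closedBall (0 : E) R).image_of_continuousOn
        (hφ'.continuous.continuousOn)).isClosed
    have hxK : x ∉ φ.symm '' Metric.closedBall (0 : E) R := by
      rintro ⟨y, -, rfl⟩
      exact hxs (φ.map_target (by simp [htarget]))
    have hev : chartTransport φ s =ᶠ[𝓝 x] id :=
      Filter.eventuallyEq_of_mem (hK.isOpen_compl.mem_nhds hxK)
        fun z hz ↦ chartTransport_eq_self hs hz
    exact contMDiffAt_id.congr_of_eventuallyEq hev

/-- **Transport of a compactly supported diffeomorphism of `E` along a disc** in a manifold with
arbitrary model with corners (Hirsch (1976), Ch. 8 §1, Thms. 1.3–1.4, static form; compare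
`exists_diffeomorph_chartTransport` for boundaryless `N`): for a disc `k : E → N` and a
diffeomorphism `s` of `E` with `s = id` off `B̄(0, R)`, there is a diffeomorphism `γ` of `N` with
`γ (k y) = k (s y)` for all `y` and `γ = id` off `k '' B̄(0, R)`. [folklore] -/
theorem exists_diffeomorph_discTransport {k : E → N}
    (hk : Manifold.IsSmoothEmbedding 𝓘(ℝ, E) I ∞ k) (s : E ≃ₘ⟮𝓘(ℝ, E), 𝓘(ℝ, E)⟯ E) {R : ℝ}
    (hs : ∀ y, R ≤ ‖y‖ → s y = y) :
    ∃ γ : N ≃ₘ⟮I, I⟯ N, (∀ y, γ (k y) = k (s y)) ∧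
      ∀ b, b ∉ k '' Metric.closedBall (0 : E) R → γ b = b := by
  set Φ := (isOpenEmbedding_disc hk).toOpenPartialHomeomorph k with hΦ
  set φ : OpenPartialHomeomorph N E := Φ.symm with hφ
  have hφsymm : ⇑φ.symm = k := by simp [hφ, hΦ]
  have htarget : φ.target = univ := by simp [hφ, hΦ]
  have hφ' : ContMDiff 𝓘(ℝ, E) I ∞ φ.symm := by rw [hφsymm]; exact hk.contMDiff
  have hφc : ContMDiffOn I 𝓘(ℝ, E) ∞ φ φ.source := by
    have h := contMDiffOn_symm_disc hk
    have hsrc : φ.source = range k := by simp [hφ, hΦ]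
    rw [hsrc]
    exact h
  have hs' : ∀ y, R ≤ ‖y‖ → s.symm y = y := fun y hy ↦ by
    conv_lhs => rw [← hs y hy]
    exact s.symm_apply_apply y
  let γ : N ≃ₘ⟮I, I⟯ N :=
    { toFun := chartTransport φ s
      invFun := chartTransport φ s.symm
      left_inv := chartTransport_chartTransport htarget s.symm_apply_apply
      right_inv := chartTransport_chartTransport htarget s.apply_symm_apply
      contMDiff_toFun := contMDiff_chartTransport_of_model hφc hφ' htarget s.contMDiff hs
      contMDiff_invFun := contMDiff_chartTransport_of_model hφc hφ' htarget s.symm.contMDiff hs' }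
  refine ⟨γ, fun y => ?_, fun b hb => ?_⟩
  · have h := chartTransport_symm_apply htarget s y
    rw [hφsymm] at h
    exact h
  · refine chartTransport_eq_self hs ?_
    rwa [hφsymm]

end DiscTransport

/-! ### Restricting a smooth embedding of an open submanifold to a smaller open -/

section Inclusion

variable {E : Type*} [NormedAddCommGroup E] [NormedSpace ℝ E]
  {H : Type*} [TopologicalSpace H] {I : ModelWithCorners ℝ E H}
  {N : Type*} [TopologicalSpace N] [ChartedSpace H N]

/-- The inclusion of a smaller open `U ≤ V` of `N` into `V`, as a partial homeomorphism `U ⇀ V`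
with source `univ` (the one attached to the open embedding `Opens.inclusion h`, Mathlib's
`Opens.isOpenEmbedding_of_le`). [folklore] -/
def inclusionOpenPartialHomeomorph {U V : Opens N} (h : U ≤ V) [Nonempty U] :
    OpenPartialHomeomorph U V :=
  (Opens.isOpenEmbedding_of_le h).toOpenPartialHomeomorph _

/-- The inclusion partial homeomorphism is `Opens.inclusion h` as a map. [folklore] -/
@[simp] theorem inclusionOpenPartialHomeomorph_coe {U V : Opens N} (h : U ≤ V) [Nonempty U] :
    ⇑(inclusionOpenPartialHomeomorph h) = Opens.inclusion h := rfl

/-- The inclusion partial homeomorphism has source `univ`. [folklore] -/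
@[simp] theorem inclusionOpenPartialHomeomorph_source {U V : Opens N} (h : U ≤ V) [Nonempty U] :
    (inclusionOpenPartialHomeomorph h).source = univ := by
  simp [inclusionOpenPartialHomeomorph]

/-- The inclusion partial homeomorphism has target the range of the inclusion,
`{v | ↑v ∈ U}`. [folklore] -/
theorem inclusionOpenPartialHomeomorph_target {U V : Opens N} (h : U ≤ V) [Nonempty U] :
    (inclusionOpenPartialHomeomorph h).target = range (Opens.inclusion h) := by
  simp [inclusionOpenPartialHomeomorph]

/-- The inclusion partial homeomorphism is `C^∞` on its source. [folklore] -/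
theorem contMDiffOn_inclusionOpenPartialHomeomorph {U V : Opens N} (h : U ≤ V) [Nonempty U] :
    ContMDiffOn I I ∞ (inclusionOpenPartialHomeomorph h) (inclusionOpenPartialHomeomorph h).source := by
  rw [inclusionOpenPartialHomeomorph_coe]
  exact (contMDiff_inclusion h).contMDiffOn

/-- The inverse of the inclusion partial homeomorphism is `C^∞` on its target: composed with
`Subtype.val : U → N` it is `Subtype.val : V → N` there. [folklore] -/
theorem contMDiffOn_inclusionOpenPartialHomeomorph_symm {U V : Opens N} (h : U ≤ V) [Nonempty U] :
    ContMDiffOn I I ∞ (inclusionOpenPartialHomeomorph h).symm (inclusionOpenPartialHomeomorph h).target := by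
  intro v hv
  rw [← ContMDiffWithinAt.subtypeVal_comp_iff]
  have hev : ∀ v' ∈ (inclusionOpenPartialHomeomorph h).target,
      (Subtype.val ∘ (inclusionOpenPartialHomeomorph h).symm) v' = (v' : N) := by
    intro v' hv'
    rw [inclusionOpenPartialHomeomorph_target] at hv'
    obtain ⟨u, rfl⟩ := hv'
    simp only [comp_apply]
    rw [show (inclusionOpenPartialHomeomorph h).symm (Opens.inclusion h u) = u from
      (Opens.isOpenEmbedding_of_le h).toOpenPartialHomeomorph_left_inv]
  exact (contMDiff_subtype_val (I := I) (n := ∞) (U := V) v).contMDiffWithinAt.congr hev (hev v hv)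

variable {E' : Type*} [NormedAddCommGroup E'] [NormedSpace ℝ E'] {H' : Type*}
  [TopologicalSpace H'] {J : ModelWithCorners ℝ E' H'} {P : Type*}

/-- The range of `f ∘ Opens.inclusion h` is the image under `f` of `{v | ↑v ∈ U}`. [folklore] -/
theorem range_comp_inclusion {U V : Opens N} (h : U ≤ V) (f : V → P) :
    range (f ∘ Opens.inclusion h) = f '' {v : V | (v : N) ∈ U} := by
  rw [range_comp]
  congr 1
  ext v
  constructor
  · rintro ⟨u, rfl⟩; exact u.2
  · intro hv; exact ⟨⟨v.1, hv⟩, rfl⟩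

/-- If `f : V → P` is an open map then `range (f ∘ Opens.inclusion h)` is open. [folklore] -/
theorem isOpen_range_comp_inclusion [TopologicalSpace P] {U V : Opens N} (h : U ≤ V) {f : V → P}
    (hf : IsOpenMap f) : IsOpen (range (f ∘ Opens.inclusion h)) := by
  rw [range_comp_inclusion]
  exact hf _ (U.2.preimage continuous_subtype_val)

/-- **A smooth embedding of an open submanifold restricts to a smooth embedding of any smaller
open, with open range if the range was open** (Lee, *Introduction to Smooth Manifolds* (2013),
Ch. 5): for `U ≤ V` opens of `N` and a smooth embedding `f : V → P`, the composite
`f ∘ Opens.inclusion h : U → P` is a smooth embedding, and its range is open whenever `range f`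
is. For nonempty `U` this is `Manifold.IsSmoothEmbedding.comp_openPartialHomeomorph` applied
to `inclusionOpenPartialHomeomorph`; for empty `U` it is vacuous. [folklore] -/
theorem isSmoothEmbedding_comp_opensInclusion [IsManifold I ∞ N] [TopologicalSpace P]
    [ChartedSpace H' P] {U V : Opens N} (h : U ≤ V) {f : V → P}
    (hf : Manifold.IsSmoothEmbedding I J ∞ f) :
    Manifold.IsSmoothEmbedding I J ∞ (f ∘ Opens.inclusion h) ∧
      (IsOpen (range f) → IsOpen (range (f ∘ Opens.inclusion h))) := by
  refine ⟨?_, fun ho => isOpen_range_comp_inclusion h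
    (Topology.IsOpenEmbedding.mk hf.isEmbedding ho).isOpenMap⟩
  rcases isEmpty_or_nonempty U with hU | hU
  · exact ⟨Manifold.IsImmersionOfComplement.isImmersion (F := Unit) fun x => isEmptyElim x,
      hf.isEmbedding.comp (Opens.isOpenEmbedding_of_le h).isEmbedding⟩
  · rw [← inclusionOpenPartialHomeomorph_coe h]
    exact hf.comp_openPartialHomeomorph (inclusionOpenPartialHomeomorph h)
      (inclusionOpenPartialHomeomorph_source h) (contMDiffOn_inclusionOpenPartialHomeomorph h)
      (contMDiffOn_inclusionOpenPartialHomeomorph_symm h)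

end Inclusion

end Literature.Topology.FourManifolds
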